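import Literature.AnabelianGeometry.EtaleTheta.Discharge.Sec2ThetaGroupCommutators
import Literature.AnabelianGeometry.EtaleTheta.Discharge.Sec2DeltaThetaTorsionFree
import HarnessLib

/-!
# [EtTh] §1 p. 12: the tempered `Δ_Θ` IS the profinite `[Δ_X,Δ_X]⁻/[[Δ_X,Δ_X],Δ_X]⁻`, and `l·Δ_Θ ≅ Δ_Θ`
# (proof-only; the TRANSPORT half of "`Δ_Θ ≅ Ẑ(1)`" for the §1 model — GAP-LEDGER row G-w4d021-1)

Mochizuki, *The étale theta function and its Frobenioid-theoretic manifestations*, Publ. RIMS **45**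
(2009) [EtTh], §1, PRIMS PDF p. 12 (printed 238): "we also have a natural exact sequence
`1 → ∧² Δ^ell_X (≅ Ẑ(1)) → Δ^Θ_X → Δ^ell_X → 1` … `(Ẑ(1) ≅) Δ_Θ ⊆ Δ^Θ_X` … `1 → Δ_Θ → (Δ^tp_Y)^Θ → (Δ^tp_Y)^ell → 1`"
[cite: MochizukiEtTh2009, §1 p.12]. Layer L2 of the abc-iut cell, seat abc-iut-L2-d1 (gen 3), PROOF-ONLY
companion of `Setting.lean` (abc-iut-L2-t1): no definition, no statement of another seat is edited or
restated.

WHY THIS FILE. The root file `Setting.lean` (v3) types the theta quotient `(Π^tp_X)^Θ = D.GtpTheta` as an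
ABSTRACT topological group with the printed kernel `Ker(Π^tp_X ↠ (Π^tp_X)^Θ) = ι⁻¹ [[Δ_X,Δ_X],Δ_X]⁻`
(`ι : Π^tp_X → Π_X` the profinite completion), so the tempered `Δ_Θ := Ker((Π^tp_X)^Θ ↠ (Π^tp_X)^ell)`
is, as an abstract group, `ι⁻¹K₂ / ι⁻¹K₃` (`K₂ = [Δ_X,Δ_X]⁻`, `K₃ = [[Δ_X,Δ_X],Δ_X]⁻`), which EMBEDS into
the profinite `K₂/K₃` but need not fill it: density of `Δ^tp_X` in `Δ_X` alone only puts `⁅a,b⁆^ℤ` inside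
(the discrete-image model `Δ^tp_X ↦ F₂ ⊂ F̂₂` satisfies the root axioms and has `Δ_Θ ≅ ℤ`). The printed
sentence "(Δ^tp_Y)^Θ is an abelian PROFINITE group" (pp. 12–13) is what closes the gap; its commutativity
half `hYab` is a THEOREM (`ThetaSetting.dtpYTheta_comm`, abc-iut-L2-t8), its closedness half is the binder
`hYcl` of the §2 rigidity chain (GAP-LEDGER row G-w4d021-2: "the image of `Δ^tp_Y` in `Δ^Θ_X` is closed",
not derivable from `Setting` v3 — finer-topology model). Consumers of "`(l·Δ_Θ)(M) ≅ Ẑ(1)`" (the Tate-curve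
forms of [IUTchII] Prop. 1.2 (i), `Literature.IUT.HodgeArakelov.ThetaSetting.prop12_i_indeterminacy_envOfGroup_…`,
binder `hZ`, GAP-LEDGER row G-w4d021-1) already carry `hYcl` and `IsEtThOrigin`; this file and its sequel
(`Sec1DeltaThetaZHat.lean`, composing with the pure profinite core `K₂/K₃ ≅ Ẑ` of
`Sec1FreeTwoHeisenbergZHat.lean`, seat abc-iut-w5-d171) ELIMINATE `hZ` in favour of those.

WHAT IS PROVED (for `D : ThetaSetting p`, guard `hO : D.IsEtThOrigin`, binder `hYcl`):
* `ThetaSetting.nonempty_deltaTheta_mulEquiv_of_commutatorQuotient` — for ANY group `H` and any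
  surjection `ψ : K₂ ↠ H` whose kernel is exactly `K₂ ∩ K₃` (i.e. any model of `K₂/K₃`), `Δ_Θ ≃* H`:
  the tempered `Δ_Θ` IS (as an abstract group) the profinite `[Δ_X,Δ_X]⁻/[[Δ_X,Δ_X],Δ_X]⁻`
  (quotient-free phrasing, so that no normality instance enters the statement);
* `ThetaSetting.nonempty_lDeltaTheta_mulEquiv_deltaTheta` — `l·Δ_Θ ≃* Δ_Θ` for `l ≠ 0` (the `l`-th power
  map of the commutative group `Δ_Θ` is injective by torsion-freeness, `deltaTheta_torsionfree`, abc-iut-L2-t8);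
* `ThetaSetting.nonempty_lDeltaTheta_mulEquiv_of_commutatorQuotient` — the combination.

PROOF of the first (classical): with `P₂ := Ker(Π^tp_X ↠ (Π^tp_X)^ell) = ι⁻¹K₂` (`ker_toEll`), the two
surjections `β : P₂ ↠ Δ_Θ` (`θ = toTheta`, onto by `toTheta_surjective`) and `ρ := ψ ∘ ι : P₂ → H` have the
SAME kernel `P₂ ∩ ι⁻¹K₃` (`ker_toTheta`); `ρ` is onto because every `k ∈ K₂` is `ι[z₁, y] · k₃` with
`y ∈ Δ^tp_Y`, `k₃ ∈ K₃` — the Heisenberg surjectivity `exists_commutator_mul_of_mem_commutatorClosure`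
(abc-iut-L5-t14) under `hYab := dtpYTheta_comm hO` and `hYcl`. Hence `Δ_Θ ≃ P₂/Ker ≃ H`.
HONEST FRAMING: [EtTh] is refereed; the theta setting is data quoting print, not asserted to exist; OUR
kernel check of a shadow of the printed "`Δ_Θ ≅ Ẑ(1)`" (group structure only — the Galois action "(1)" is
NOT claimed); nothing here concerns or takes a side on [IUTchIII] Cor. 3.12.
-/

noncomputable section

namespace Literature.AnabelianGeometry.EtaleTheta

open Literature.AnabelianGeometry.SemiGraphs
open scoped commutatorElement

namespace ThetaSetting

variable {p : ℕ} [Fact p.Prime] (D : ThetaSetting p)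

/-- **The tempered `Δ_Θ` is the profinite `[Δ_X,Δ_X]⁻/[[Δ_X,Δ_X],Δ_X]⁻`** ([EtTh] p. 12:
"`1 → ∧² Δ^ell_X (≅ Ẑ(1)) → Δ^Θ_X → Δ^ell_X → 1` … `(Ẑ(1) ≅) Δ_Θ ⊆ Δ^Θ_X`"), quotient-free form: under the
freeness guard `IsEtThOrigin` and the closedness binder `hYcl` ("(Δ^tp_Y)^Θ is profinite", pp. 12–13), for every
group `H` and every surjective homomorphism `ψ : [Δ_X,Δ_X]⁻ ↠ H` whose kernel is exactly
`[Δ_X,Δ_X]⁻ ∩ [[Δ_X,Δ_X],Δ_X]⁻`, the tempered `Δ_Θ = Ker((Π^tp_X)^Θ ↠ (Π^tp_X)^ell)` is isomorphic to `H`.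
[cite: MochizukiEtTh2009, §1 p.12] -/
theorem nonempty_deltaTheta_mulEquiv_of_commutatorQuotient (hO : D.IsEtThOrigin)
    (hYcl : (D.DtpY.map D.toHat.toMonoidHom).topologicalClosure ≤
      D.DtpY.map D.toHat.toMonoidHom ⊔ (⁅⁅D.DeltaHat, D.DeltaHat⁆, D.DeltaHat⁆).topologicalClosure)
    {H : Type*} [Group H]
    (ψ : ↥((⁅D.DeltaHat, D.DeltaHat⁆).topologicalClosure) →* H) (hψ : Function.Surjective ψ)
    (hker : ∀ k : ↥((⁅D.DeltaHat, D.DeltaHat⁆).topologicalClosure),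
      ψ k = 1 ↔ (k : D.PiHat) ∈ (⁅⁅D.DeltaHat, D.DeltaHat⁆, D.DeltaHat⁆).topologicalClosure) :
    Nonempty (↥D.DeltaTheta ≃* H) := by
  haveI hΔn : D.DeltaHat.Normal := SettingCompletion.deltaHat_normal D.toTemperedCurve
  -- `K₃ ≤ K₂`
  have hK₃₂ : (⁅⁅D.DeltaHat, D.DeltaHat⁆, D.DeltaHat⁆).topologicalClosure ≤
      (⁅D.DeltaHat, D.DeltaHat⁆).topologicalClosure :=
    Subgroup.topologicalClosure_mono (Subgroup.commutator_le_left _ _)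
  -- a generator of `Z = Δ^tp_X/Δ^tp_Y`
  obtain ⟨⟨z₁, hz₁Δ⟩, hz₁Z'⟩ := D.toZ_delta_surjective (Multiplicative.ofAdd 1)
  have hz₁Z : D.toZ z₁ = Multiplicative.ofAdd 1 := hz₁Z'
  -- `P₂ := Ker(Π^tp_X ↠ (Π^tp_X)^ell) = ι⁻¹ K₂`
  have hP₂ : ∀ g : D.PiTemp, g ∈ (D.thetaToEll.comp D.toTheta).ker ↔
      D.toHat.toMonoidHom g ∈ (⁅D.DeltaHat, D.DeltaHat⁆).topologicalClosure := by
    intro g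
    rw [D.ker_toEll, Subgroup.mem_comap]
  -- `ι| : P₂ → K₂`
  let τ : ↥(D.thetaToEll.comp D.toTheta).ker →* ↥((⁅D.DeltaHat, D.DeltaHat⁆).topologicalClosure) :=
    (D.toHat.toMonoidHom.comp (D.thetaToEll.comp D.toTheta).ker.subtype).codRestrict _
      fun g => (hP₂ g).mp g.2
  have hτ : ∀ g : ↥(D.thetaToEll.comp D.toTheta).ker, (τ g : D.PiHat) = D.toHat.toMonoidHom g :=
    fun g => rfl
  -- `ρ := ψ ∘ ι| : P₂ → H`
  let ρ : ↥(D.thetaToEll.comp D.toTheta).ker →* H := ψ.comp τ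
  -- `β := θ| : P₂ → Δ_Θ`
  let β : ↥(D.thetaToEll.comp D.toTheta).ker →* ↥D.DeltaTheta :=
    (D.toTheta.comp (D.thetaToEll.comp D.toTheta).ker.subtype).codRestrict _ fun g => by
      change D.toTheta (g : D.PiTemp) ∈ D.thetaToEll.ker
      exact g.2
  have hβ : ∀ g : ↥(D.thetaToEll.comp D.toTheta).ker, (β g : D.GtpTheta) = D.toTheta g :=
    fun g => rfl
  -- `β` is onto
  have hβs : Function.Surjective β := by
    intro t
    obtain ⟨g, hg⟩ := D.toTheta_surjective (t : D.GtpTheta)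
    have hgP : g ∈ (D.thetaToEll.comp D.toTheta).ker := by
      rw [MonoidHom.mem_ker, MonoidHom.coe_comp, Function.comp_apply, hg]
      exact t.2
    exact ⟨⟨g, hgP⟩, Subtype.ext (by rw [hβ]; exact hg)⟩
  -- `ρ` is onto (Heisenberg surjectivity under `hYab`, `hYcl`)
  have hρs : Function.Surjective ρ := by
    intro h
    obtain ⟨k, rfl⟩ := hψ h
    obtain ⟨y, hy, k₃, hk₃, hkeq⟩ := D.exists_commutator_mul_of_mem_commutatorClosure
      (D.dtpYTheta_comm hO) hYcl hz₁Δ hz₁Z k.2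
    have hgP : z₁ * y * z₁⁻¹ * y⁻¹ ∈ (D.thetaToEll.comp D.toTheta).ker := by
      rw [hP₂]
      have h1 : D.toHat.toMonoidHom (z₁ * y * z₁⁻¹ * y⁻¹) = (k : D.PiHat) * k₃⁻¹ := by
        rw [hkeq, mul_inv_cancel_right]
      rw [h1]
      exact Subgroup.mul_mem _ k.2 (Subgroup.inv_mem _ (hK₃₂ hk₃))
    refine ⟨⟨_, hgP⟩, ?_⟩
    have hk : k = τ ⟨_, hgP⟩ * ⟨k₃, hK₃₂ hk₃⟩ := Subtype.ext (by
      rw [Subgroup.coe_mul, hτ]; exact hkeq)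
    change ψ (τ ⟨_, hgP⟩) = ψ k
    rw [hk, map_mul, (hker ⟨k₃, hK₃₂ hk₃⟩).mpr hk₃, mul_one]
  -- the two kernels coincide: `P₂ ∩ ι⁻¹ K₃`
  have hkereq : β.ker = ρ.ker := by
    ext g
    rw [MonoidHom.mem_ker, MonoidHom.mem_ker]
    change β g = 1 ↔ ψ (τ g) = 1
    rw [hker (τ g), hτ, ← Subgroup.mem_comap, ← D.ker_toTheta, MonoidHom.mem_ker, ← hβ,
      OneMemClass.coe_eq_one]
  exact ⟨(QuotientGroup.quotientKerEquivOfSurjective β hβs).symm.trans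
    ((QuotientGroup.quotientMulEquivOfEq hkereq).trans
      (QuotientGroup.quotientKerEquivOfSurjective ρ hρs))⟩

/-- **`l·Δ_Θ ≅ Δ_Θ` for `l ≠ 0`** ([EtTh] p. 12 "`(Ẑ(1) ≅) Δ_Θ`"; pp. 41, 45 "`l · Δ_Θ ⊆ Δ_Θ`"): under the
freeness guard the `l`-th power map of the commutative group `Δ_Θ` (`ker_thetaToEll_comm`) is a bijection
onto `l·Δ_Θ` — injective because `Δ_Θ` is torsion-free (`deltaTheta_torsionfree`, abc-iut-L2-t8), surjective
by the definition of `ThetaSetting.lDeltaTheta`. [cite: MochizukiEtTh2009, §1 p.12] -/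
theorem nonempty_lDeltaTheta_mulEquiv_deltaTheta (hO : D.IsEtThOrigin) {l : ℕ} (hl : l ≠ 0) :
    Nonempty (↥(D.lDeltaTheta l) ≃* ↥D.DeltaTheta) := by
  let f : ↥D.DeltaTheta →* ↥(D.lDeltaTheta l) :=
    { toFun := fun t => ⟨(t : D.GtpTheta) ^ l, (t : D.GtpTheta), t.2, rfl⟩
      map_one' := Subtype.ext (by simp)
      map_mul' := fun s t => Subtype.ext (by
        have hst : Commute (s : D.GtpTheta) (t : D.GtpTheta) := D.ker_thetaToEll_comm _ s.2 _ t.2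
        change ((s : D.GtpTheta) * t) ^ l = (s : D.GtpTheta) ^ l * (t : D.GtpTheta) ^ l
        exact hst.mul_pow l) }
  have hf : ∀ t : ↥D.DeltaTheta, (f t : D.GtpTheta) = (t : D.GtpTheta) ^ l := fun t => rfl
  have hinj : Function.Injective f := by
    intro s t hst
    have h1 : (s : D.GtpTheta) ^ l = (t : D.GtpTheta) ^ l := by
      rw [← hf, ← hf, hst]
    have hcomm : Commute (s : D.GtpTheta) (t : D.GtpTheta)⁻¹ :=
      D.ker_thetaToEll_comm _ s.2 _ (inv_mem t.2)
    have h2 : ((s : D.GtpTheta) * (t : D.GtpTheta)⁻¹) ^ l = 1 := by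
      rw [hcomm.mul_pow, inv_pow, h1, mul_inv_cancel]
    have h3 : (s : D.GtpTheta) * (t : D.GtpTheta)⁻¹ = 1 :=
      D.deltaTheta_torsionfree hO (mul_mem s.2 (inv_mem t.2)) hl h2
    exact Subtype.ext (mul_inv_eq_one.mp h3)
  have hsurj : Function.Surjective f := by
    rintro ⟨x, y, hy, rfl⟩
    exact ⟨⟨y, hy⟩, rfl⟩
  exact ⟨(MulEquiv.ofBijective f ⟨hinj, hsurj⟩).symm⟩

/-- **`l·Δ_Θ` is the profinite `[Δ_X,Δ_X]⁻/[[Δ_X,Δ_X],Δ_X]⁻`** (combination of the two previous results):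
under `IsEtThOrigin`, `hYcl` and `l ≠ 0`, every model `ψ : [Δ_X,Δ_X]⁻ ↠ H` of `K₂/K₃` gives `l·Δ_Θ ≃* H`.
[cite: MochizukiEtTh2009, §1 p.12] -/
theorem nonempty_lDeltaTheta_mulEquiv_of_commutatorQuotient (hO : D.IsEtThOrigin)
    (hYcl : (D.DtpY.map D.toHat.toMonoidHom).topologicalClosure ≤
      D.DtpY.map D.toHat.toMonoidHom ⊔ (⁅⁅D.DeltaHat, D.DeltaHat⁆, D.DeltaHat⁆).topologicalClosure)
    {l : ℕ} (hl : l ≠ 0) {H : Type*} [Group H]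
    (ψ : ↥((⁅D.DeltaHat, D.DeltaHat⁆).topologicalClosure) →* H) (hψ : Function.Surjective ψ)
    (hker : ∀ k : ↥((⁅D.DeltaHat, D.DeltaHat⁆).topologicalClosure),
      ψ k = 1 ↔ (k : D.PiHat) ∈ (⁅⁅D.DeltaHat, D.DeltaHat⁆, D.DeltaHat⁆).topologicalClosure) :
    Nonempty (↥(D.lDeltaTheta l) ≃* H) := by
  obtain ⟨e₁⟩ := D.nonempty_lDeltaTheta_mulEquiv_deltaTheta hO hl
  obtain ⟨e₂⟩ := D.nonempty_deltaTheta_mulEquiv_of_commutatorQuotient hO hYcl ψ hψ hker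
  exact ⟨e₁.trans e₂⟩

end ThetaSetting

end Literature.AnabelianGeometry.EtaleTheta

end
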